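import Literature.Analysis.FluidPDE.NewtonPotentialHolder
import Mathlib.Analysis.SpecialFunctions.JapaneseBracket
import Mathlib.Analysis.InnerProductSpace.Calculus
import Mathlib.Analysis.SpecialFunctions.Pow.Deriv
import HarnessLib

/-!
# The regularised gradient of the Newtonian kernel and its approximate identity

Analysis/FluidPDE support file on the discharge path of the named fact
`Literature.Analysis.FluidPDE.ShirotaYanagisawa1993_periodicCylinderLogDivCurlEstimate`
(`Ferrari1993LogEstimateReduction.lean`; Shirota–Yanagisawa 1993, (15) p. 80). The discharge
(see `LogLipschitzKernelBounds.lean`) uses a whole-space Biot–Savart identity for *Lipschitz*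
compactly supported fields `w`, obtained without principal values or distribution theory from the
**regularised kernels**

* `regNewtonGrad ε j z = zⱼ / (4π (|z|² + ε²)^{3/2})` — for `ε = 0` the gradient
  `∂ⱼΓ(z) = zⱼ/(4π|z|³)` of the Newtonian kernel `Γ = −1/(4π|z|)` (`newtonKernelGrad`), i.e.
  `regNewtonGrad ε j = ∂ⱼΓ_ε` with `Γ_ε(z) = −(4π)⁻¹ (|z|² + ε²)^{-1/2}`;
* `regDelta ε z = 3ε² / (4π (|z|² + ε²)^{5/2}) = Σⱼ ∂ⱼ(regNewtonGrad ε j)(z) = ΔΓ_ε(z)` — a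
  positive approximate identity (`regDelta ε = ε⁻³ regDelta 1 (·/ε)`, total mass
  `m₀ = ∫ regDelta 1 ∈ (0, ∞)`),

which for `ε ≠ 0` are smooth and globally Lipschitz (so that Mathlib's integration by parts for
Lipschitz functions, `LipschitzWith.integral_lineDeriv_mul_eq`, applies to `∫ ∂ⱼΓ_ε(x − y) w(y) dy`),
while satisfying the size and Hörmander bounds of a singular kernel of degree `-2`
(`isSingularKernel_regNewtonGrad`: `A = (4π)⁻¹`, `B = 8/π`) **uniformly in `ε`**, so that the
log-Lipschitz bounds of `LogLipschitzKernelBounds.lean` hold with constants independent of `ε`.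
Proved here:

* `hasFDerivAt_regNewtonGrad`, `fderiv_regNewtonGrad_apply`:
  `D(regNewtonGrad ε j)(z) h = (4π)⁻¹ (hⱼ s^{-3/2} − 3 zⱼ ⟨z, h⟩ s^{-5/2})`, `s = |z|² + ε²`;
  symmetry `∂ᵢ regNewtonGrad ε j = ∂ⱼ regNewtonGrad ε i` (`fderiv_regNewtonGrad_symm`) and the
  divergence identity `Σⱼ ∂ⱼ regNewtonGrad ε j = regDelta ε` (`sum_fderiv_regNewtonGrad`);
* `norm_fderiv_regNewtonGrad_le`: `‖D(regNewtonGrad ε j)(z)‖ ≤ π⁻¹ s^{-3/2}`, whence the global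
  Lipschitz bound (`lipschitzWith_regNewtonGrad`) and `isSingularKernel_regNewtonGrad`;
* `regDelta`: positivity, scaling, integrability of `regDelta 1` and of `|z| regDelta 1 z`
  (Japanese bracket, `integrable_rpow_neg_one_add_norm_sq`), and the **approximate identity
  estimate** `abs_integral_regDelta_mul_sub_le`: for an `L`-Lipschitz `g`,
  `|∫ regDelta ε (x − y) g(y) dy − m₀ g(x)| ≤ L |ε| m₁`, `m₁ = ∫ |z| regDelta 1 z dz`.

## Mathlib / tree search

Tree: `newtonKernelGrad`, `isSingularKernel_newtonKernelGrad`, `half_norm_le_of_mem_segment`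
(`NewtonPotentialHolder`; the `ε = 0` case, whose proof pattern is followed); no regularised
Newtonian kernel in the tree (`lean search 'regNewton|regulari[sz]ed.*[kK]ernel|ε \^ 2\) \^'`:
nothing). Mathlib (used): `HasFDerivAt.rpow_const`, `HasFDerivAt.norm_sq`, `PiLp.proj`,
`lipschitzWith_of_nnnorm_fderiv_le`, `Convex.norm_image_sub_le_of_norm_fderiv_le`,
`Measure.integral_comp_inv_smul`, `integral_sub_left_eq_self`, `LipschitzWith.norm_sub_le`,
`integrable_rpow_neg_one_add_norm_sq`, `integral_pos_iff_support_of_nonneg`.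

## References

* A. J. Majda, A. L. Bertozzi, *Vorticity and Incompressible Flow*, CUP 2002, §2.4.1
  (regularised Biot–Savart kernels) and Lemma 8.1. [MajdaBertozziCUP2002]
* D. Gilbarg, N. S. Trudinger, *Elliptic Partial Differential Equations of Second Order* (2001),
  §4.1 (the Newtonian kernel). [GilbargTrudinger2001]
-/

noncomputable section

open MeasureTheory Set Function Filter Metric Real
open _root_.Topology
open scoped NNReal ENNReal RealInnerProductSpace

namespace Literature.Analysis.FluidPDE

namespace NewtonPotentialHolder

/-! ### Definitions -/

/-- The **regularised gradient of the Newtonian kernel**,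
`regNewtonGrad ε j z = zⱼ / (4π (|z|² + ε²)^{3/2}) = ∂ⱼΓ_ε(z)`, `Γ_ε = −(4π)⁻¹(|z|² + ε²)^{-1/2}`
(Majda–Bertozzi §2.4.1-type regularisation; for `ε = 0` and `z ≠ 0` it is `∂ⱼΓ(z) = zⱼ/(4π|z|³)`).
[folklore] -/
def regNewtonGrad (ε : ℝ) (j : Fin 3) (z : EuclideanSpace ℝ (Fin 3)) : ℝ :=
  (4 * π)⁻¹ * z j * (‖z‖ ^ 2 + ε ^ 2) ^ (-(3 / 2 : ℝ))

/-- The **approximate identity** `regDelta ε z = 3ε² / (4π (|z|² + ε²)^{5/2}) = ΔΓ_ε(z)`, the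
divergence of the regularised gradient kernel (`sum_fderiv_regNewtonGrad`). [folklore] -/
def regDelta (ε : ℝ) (z : EuclideanSpace ℝ (Fin 3)) : ℝ :=
  (4 * π)⁻¹ * (3 * ε ^ 2) * (‖z‖ ^ 2 + ε ^ 2) ^ (-(5 / 2 : ℝ))

variable {ε : ℝ}

/-- `|z|² + ε² > 0` for `ε ≠ 0`. [folklore] -/
theorem normSq_add_sq_pos (hε : ε ≠ 0) (z : EuclideanSpace ℝ (Fin 3)) : 0 < ‖z‖ ^ 2 + ε ^ 2 := by
  have : 0 < ε ^ 2 := by positivity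
  positivity

/-- Unfolding lemma for `regNewtonGrad`. [folklore] -/
theorem regNewtonGrad_apply (ε : ℝ) (j : Fin 3) (z : EuclideanSpace ℝ (Fin 3)) :
    regNewtonGrad ε j z = (4 * π)⁻¹ * z j * (‖z‖ ^ 2 + ε ^ 2) ^ (-(3 / 2 : ℝ)) := rfl

/-- Unfolding lemma for `regDelta`. [folklore] -/
theorem regDelta_apply (ε : ℝ) (z : EuclideanSpace ℝ (Fin 3)) :
    regDelta ε z = (4 * π)⁻¹ * (3 * ε ^ 2) * (‖z‖ ^ 2 + ε ^ 2) ^ (-(5 / 2 : ℝ)) := rfl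

/-! ### Smoothness and the derivative -/

/-- `z ↦ |z|² + ε²` has derivative `h ↦ 2⟨z, h⟩`. [folklore] -/
theorem hasFDerivAt_normSq_add_sq (ε : ℝ) (z : EuclideanSpace ℝ (Fin 3)) :
    HasFDerivAt (fun w : EuclideanSpace ℝ (Fin 3) => ‖w‖ ^ 2 + ε ^ 2)
      (2 • innerSL ℝ z) z := by
  have h := ((hasFDerivAt_id z).norm_sq).add_const (ε ^ 2)
  simpa using h

/-- The regularised kernel through the inner product with `eⱼ`:
`regNewtonGrad ε j w = (4π)⁻¹ (⟨eⱼ, w⟩ (|w|² + ε²)^{-3/2})`. [folklore] -/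
theorem regNewtonGrad_eq_inner (ε : ℝ) (j : Fin 3) (w : EuclideanSpace ℝ (Fin 3)) :
    regNewtonGrad ε j w =
      (4 * π)⁻¹ * (innerSL ℝ (EuclideanSpace.single j (1 : ℝ)) w *
        (‖w‖ ^ 2 + ε ^ 2) ^ (-(3 / 2 : ℝ))) := by
  rw [regNewtonGrad_apply, innerSL_apply_apply, EuclideanSpace.inner_single_left, map_one, one_mul,
    mul_assoc]

/-- **The derivative of the regularised kernel** exists for `ε ≠ 0` and is given by
`D(regNewtonGrad ε j)(z) h = (4π)⁻¹ (hⱼ s^{-3/2} − 3 zⱼ ⟨z, h⟩ s^{-5/2})`, `s = |z|² + ε²`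
(product and chain rules). [folklore] -/
theorem hasFDerivAt_regNewtonGrad (hε : ε ≠ 0) (j : Fin 3) (z : EuclideanSpace ℝ (Fin 3)) :
    HasFDerivAt (regNewtonGrad ε j)
      ((4 * π)⁻¹ • ((innerSL ℝ (EuclideanSpace.single j (1 : ℝ)) z) •
          ((-(3 / 2 : ℝ) * (‖z‖ ^ 2 + ε ^ 2) ^ (-(3 / 2 : ℝ) - 1)) • (2 • innerSL ℝ z)) +
        ((‖z‖ ^ 2 + ε ^ 2) ^ (-(3 / 2 : ℝ))) • innerSL ℝ (EuclideanSpace.single j (1 : ℝ)))) z := by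
  have hs : ‖z‖ ^ 2 + ε ^ 2 ≠ 0 := (normSq_add_sq_pos hε z).ne'
  have hr := (hasFDerivAt_normSq_add_sq ε z).rpow_const (p := -(3 / 2 : ℝ)) (Or.inl hs)
  have hprod := ((innerSL ℝ (EuclideanSpace.single j (1 : ℝ))).hasFDerivAt (x := z)).mul hr
  have h := hprod.const_mul (4 * π)⁻¹
  refine h.congr_of_eventuallyEq (Eventually.of_forall fun w => ?_)
  simp only [Pi.mul_apply, regNewtonGrad_eq_inner]

/-- Applied form of the derivative: for `ε ≠ 0`,
`D(regNewtonGrad ε j)(z) h = (4π)⁻¹ (hⱼ s^{-3/2} − 3 zⱼ ⟨z, h⟩ s^{-5/2})`, `s = |z|² + ε²`.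
[folklore] -/
theorem fderiv_regNewtonGrad_apply (hε : ε ≠ 0) (j : Fin 3) (z h : EuclideanSpace ℝ (Fin 3)) :
    fderiv ℝ (regNewtonGrad ε j) z h =
      (4 * π)⁻¹ * (h j * (‖z‖ ^ 2 + ε ^ 2) ^ (-(3 / 2 : ℝ)) -
        3 * z j * ⟪z, h⟫ * (‖z‖ ^ 2 + ε ^ 2) ^ (-(5 / 2 : ℝ))) := by
  rw [(hasFDerivAt_regNewtonGrad hε j z).fderiv]
  have e : (-(3 / 2 : ℝ) - 1) = -(5 / 2 : ℝ) := by norm_num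
  rw [e]
  simp only [smul_apply, add_apply, innerSL_apply_apply, EuclideanSpace.inner_single_left, map_one,
    one_mul, smul_eq_mul, nsmul_eq_mul, Nat.cast_ofNat]
  ring

/-- The regularised kernel is smooth for `ε ≠ 0`. [folklore] -/
theorem contDiff_regNewtonGrad (hε : ε ≠ 0) (j : Fin 3) {n : WithTop ℕ∞} :
    ContDiff ℝ n (regNewtonGrad ε j) := by
  have e : regNewtonGrad ε j =
      fun w : EuclideanSpace ℝ (Fin 3) => (4 * π)⁻¹ * w j * (‖w‖ ^ 2 + ε ^ 2) ^ (-(3 / 2 : ℝ)) := by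
    funext w; rfl
  rw [e]
  refine (contDiff_const.mul (EuclideanSpace.proj (𝕜 := ℝ) j).contDiff).mul ?_
  exact (contDiff_norm_sq ℝ |>.add contDiff_const).rpow_const_of_ne fun w =>
    (normSq_add_sq_pos hε w).ne'

/-- The regularised kernel is differentiable for `ε ≠ 0`. [folklore] -/
theorem differentiable_regNewtonGrad (hε : ε ≠ 0) (j : Fin 3) :
    Differentiable ℝ (regNewtonGrad ε j) := fun z =>
  (hasFDerivAt_regNewtonGrad hε j z).differentiableAt

/-- The regularised kernel is continuous for `ε ≠ 0`. [folklore] -/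
theorem continuous_regNewtonGrad (hε : ε ≠ 0) (j : Fin 3) : Continuous (regNewtonGrad ε j) :=
  (differentiable_regNewtonGrad hε j).continuous

/-- The regularised kernel is measurable for `ε ≠ 0`. [folklore] -/
theorem measurable_regNewtonGrad (hε : ε ≠ 0) (j : Fin 3) : Measurable (regNewtonGrad ε j) :=
  (continuous_regNewtonGrad hε j).measurable

/-! ### Symmetry and the divergence identity -/

/-- **Symmetry of the derivative**: `∂ᵢ(regNewtonGrad ε j) = ∂ⱼ(regNewtonGrad ε i)` (both are
second derivatives of `Γ_ε`). [folklore] -/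
theorem fderiv_regNewtonGrad_symm (hε : ε ≠ 0) (i j : Fin 3) (z : EuclideanSpace ℝ (Fin 3)) :
    fderiv ℝ (regNewtonGrad ε j) z (EuclideanSpace.single i 1) =
      fderiv ℝ (regNewtonGrad ε i) z (EuclideanSpace.single j 1) := by
  rw [fderiv_regNewtonGrad_apply hε, fderiv_regNewtonGrad_apply hε,
    EuclideanSpace.inner_single_right, EuclideanSpace.inner_single_right]
  simp only [PiLp.single_apply, RCLike.conj_to_real, one_mul]
  by_cases hij : j = i
  · subst hij; rfl
  · have hji : ¬ i = j := fun h => hij h.symm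
    simp only [hij, hji, if_false]
    ring

/-- **The divergence identity** `Σⱼ ∂ⱼ(regNewtonGrad ε j)(z) = regDelta ε z` (`ΔΓ_ε = regDelta ε`:
`Σⱼ (s^{-3/2} − 3zⱼ² s^{-5/2}) = 3 s^{-5/2}(s − |z|²) = 3ε² s^{-5/2}`). [folklore] -/
theorem sum_fderiv_regNewtonGrad (hε : ε ≠ 0) (z : EuclideanSpace ℝ (Fin 3)) :
    ∑ j, fderiv ℝ (regNewtonGrad ε j) z (EuclideanSpace.single j 1) = regDelta ε z := by
  have hs : 0 < ‖z‖ ^ 2 + ε ^ 2 := normSq_add_sq_pos hε z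
  set s : ℝ := ‖z‖ ^ 2 + ε ^ 2 with hs_def
  have hterm : ∀ j : Fin 3, fderiv ℝ (regNewtonGrad ε j) z (EuclideanSpace.single j 1) =
      (4 * π)⁻¹ * (s ^ (-(3 / 2 : ℝ)) - 3 * (z j) ^ 2 * s ^ (-(5 / 2 : ℝ))) := by
    intro j
    rw [fderiv_regNewtonGrad_apply hε, EuclideanSpace.inner_single_right]
    simp only [PiLp.single_apply, if_true, RCLike.conj_to_real, one_mul]
    ring
  simp_rw [hterm]
  rw [← Finset.mul_sum, Finset.sum_sub_distrib, Finset.sum_const, Finset.card_univ,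
    Fintype.card_fin, ← Finset.sum_mul, ← Finset.mul_sum]
  have hnorm : ∑ j : Fin 3, (z j) ^ 2 = ‖z‖ ^ 2 := (EuclideanSpace.real_norm_sq_eq z).symm
  rw [hnorm, regDelta_apply, ← hs_def]
  have e32 : s ^ (-(3 / 2 : ℝ)) = s * s ^ (-(5 / 2 : ℝ)) := by
    rw [show (-(3 / 2 : ℝ)) = -(5 / 2 : ℝ) + 1 by norm_num, Real.rpow_add_one hs.ne']
    ring
  rw [e32]
  simp only [nsmul_eq_mul, Nat.cast_ofNat]
  have hz2 : ‖z‖ ^ 2 = s - ε ^ 2 := by rw [hs_def]; ring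
  rw [hz2]
  ring

/-! ### Size of the derivative: Lipschitz and singular-kernel bounds -/

/-- **Bound on the derivative**: `‖D(regNewtonGrad ε j)(z)‖ ≤ π⁻¹ (|z|² + ε²)^{-3/2}` for
`ε ≠ 0` (`|hⱼ| ≤ |h|`, `|zⱼ| |⟨z,h⟩| ≤ |z|² |h| ≤ s |h|`). [folklore] -/
theorem norm_fderiv_regNewtonGrad_le (hε : ε ≠ 0) (j : Fin 3) (z : EuclideanSpace ℝ (Fin 3)) :
    ‖fderiv ℝ (regNewtonGrad ε j) z‖ ≤ π⁻¹ * (‖z‖ ^ 2 + ε ^ 2) ^ (-(3 / 2 : ℝ)) := by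
  have hs : 0 < ‖z‖ ^ 2 + ε ^ 2 := normSq_add_sq_pos hε z
  set s : ℝ := ‖z‖ ^ 2 + ε ^ 2 with hs_def
  have hs32 : 0 < s ^ (-(3 / 2 : ℝ)) := Real.rpow_pos_of_pos hs _
  have hs52 : 0 < s ^ (-(5 / 2 : ℝ)) := Real.rpow_pos_of_pos hs _
  refine ContinuousLinearMap.opNorm_le_bound _ (by positivity) fun h => ?_
  rw [fderiv_regNewtonGrad_apply hε, ← hs_def, Real.norm_eq_abs]
  have h1 : |h j| ≤ ‖h‖ := by
    have := PiLp.norm_apply_le (p := 2) h j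
    rwa [Real.norm_eq_abs] at this
  have h2 : |z j| ≤ ‖z‖ := by
    have := PiLp.norm_apply_le (p := 2) z j
    rwa [Real.norm_eq_abs] at this
  have h3 : |⟪z, h⟫| ≤ ‖z‖ * ‖h‖ := abs_real_inner_le_norm z h
  have e32 : s ^ (-(3 / 2 : ℝ)) = s * s ^ (-(5 / 2 : ℝ)) := by
    rw [show (-(3 / 2 : ℝ)) = -(5 / 2 : ℝ) + 1 by norm_num, Real.rpow_add_one hs.ne']
    ring
  have hz2 : ‖z‖ ^ 2 ≤ s := by rw [hs_def]; nlinarith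
  have hpi : 0 < (4 * π)⁻¹ := by positivity
  calc |(4 * π)⁻¹ * (h j * s ^ (-(3 / 2 : ℝ)) - 3 * z j * ⟪z, h⟫ * s ^ (-(5 / 2 : ℝ)))|
      = (4 * π)⁻¹ * |h j * s ^ (-(3 / 2 : ℝ)) - 3 * z j * ⟪z, h⟫ * s ^ (-(5 / 2 : ℝ))| := by
        rw [abs_mul, abs_of_pos hpi]
    _ ≤ (4 * π)⁻¹ * (|h j| * s ^ (-(3 / 2 : ℝ)) + 3 * |z j| * |⟪z, h⟫| * s ^ (-(5 / 2 : ℝ))) := by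
        gcongr
        refine (abs_sub _ _).trans (le_of_eq ?_)
        rw [abs_mul, abs_of_pos hs32, abs_mul, abs_of_pos hs52, abs_mul, abs_mul,
          abs_of_pos (by norm_num : (0 : ℝ) < 3)]
    _ ≤ (4 * π)⁻¹ * (‖h‖ * s ^ (-(3 / 2 : ℝ)) + 3 * ‖z‖ * (‖z‖ * ‖h‖) * s ^ (-(5 / 2 : ℝ))) := by
        gcongr
    _ = (4 * π)⁻¹ * ‖h‖ * s ^ (-(5 / 2 : ℝ)) * (s + 3 * ‖z‖ ^ 2) := by rw [e32]; ring
    _ ≤ (4 * π)⁻¹ * ‖h‖ * s ^ (-(5 / 2 : ℝ)) * (s + 3 * s) := by gcongr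
    _ = π⁻¹ * s ^ (-(3 / 2 : ℝ)) * ‖h‖ := by rw [e32]; ring

/-- The derivative bound in terms of `ε` alone: `‖D(regNewtonGrad ε j)(z)‖ ≤ π⁻¹ (ε²)^{-3/2}`.
[folklore] -/
theorem norm_fderiv_regNewtonGrad_le_eps (hε : ε ≠ 0) (j : Fin 3) (z : EuclideanSpace ℝ (Fin 3)) :
    ‖fderiv ℝ (regNewtonGrad ε j) z‖ ≤ π⁻¹ * (ε ^ 2) ^ (-(3 / 2 : ℝ)) := by
  refine (norm_fderiv_regNewtonGrad_le hε j z).trans ?_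
  have hε2 : 0 < ε ^ 2 := by positivity
  exact mul_le_mul_of_nonneg_left
    (Real.rpow_le_rpow_of_nonpos hε2 (by nlinarith [norm_nonneg z]) (by norm_num)) (by positivity)

/-- The derivative bound in terms of `|z|` alone: `‖D(regNewtonGrad ε j)(z)‖ ≤ π⁻¹ |z|⁻³` for
`z ≠ 0`, uniformly in `ε ≠ 0`. [folklore] -/
theorem norm_fderiv_regNewtonGrad_le_norm (hε : ε ≠ 0) (j : Fin 3) {z : EuclideanSpace ℝ (Fin 3)}
    (hz : z ≠ 0) : ‖fderiv ℝ (regNewtonGrad ε j) z‖ ≤ π⁻¹ * (‖z‖ ^ 3)⁻¹ := by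
  have hz' : 0 < ‖z‖ := norm_pos_iff.2 hz
  refine (norm_fderiv_regNewtonGrad_le hε j z).trans (mul_le_mul_of_nonneg_left ?_ (by positivity))
  have hz2 : 0 < ‖z‖ ^ 2 := by positivity
  calc (‖z‖ ^ 2 + ε ^ 2) ^ (-(3 / 2 : ℝ)) ≤ (‖z‖ ^ 2) ^ (-(3 / 2 : ℝ)) :=
        Real.rpow_le_rpow_of_nonpos hz2 (by nlinarith [sq_nonneg ε]) (by norm_num)
    _ = (‖z‖ ^ 3)⁻¹ := by
        rw [show (‖z‖ ^ 2 : ℝ) = ‖z‖ ^ (2 : ℝ) by norm_cast, ← Real.rpow_mul hz'.le,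
          show (2 * -(3 / 2 : ℝ)) = -3 by norm_num, Real.rpow_neg hz'.le,
          show (3 : ℝ) = ((3 : ℕ) : ℝ) by norm_num, Real.rpow_natCast]

/-- **The regularised kernel is globally Lipschitz** (constant `π⁻¹ (ε²)^{-3/2}`), so that
Mathlib's integration by parts for Lipschitz functions applies to it. [folklore] -/
theorem lipschitzWith_regNewtonGrad (hε : ε ≠ 0) (j : Fin 3) :
    LipschitzWith (Real.toNNReal (π⁻¹ * (ε ^ 2) ^ (-(3 / 2 : ℝ)))) (regNewtonGrad ε j) := by
  refine lipschitzWith_of_nnnorm_fderiv_le (differentiable_regNewtonGrad hε j) fun z => ?_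
  rw [← NNReal.coe_le_coe, coe_nnnorm, Real.coe_toNNReal _ (by positivity)]
  exact norm_fderiv_regNewtonGrad_le_eps hε j z

/-- The size bound `|regNewtonGrad ε j z| ≤ (4π)⁻¹ |z|⁻²`, uniformly in `ε`. [folklore] -/
theorem abs_regNewtonGrad_le (ε : ℝ) (j : Fin 3) (z : EuclideanSpace ℝ (Fin 3)) :
    |regNewtonGrad ε j z| ≤ (4 * π)⁻¹ * ‖z‖ ^ (-2 : ℝ) := by
  by_cases hz : z = 0
  · subst hz
    simp [regNewtonGrad_apply, Real.zero_rpow (by norm_num : (-2 : ℝ) ≠ 0)]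
  have hz' : 0 < ‖z‖ := norm_pos_iff.2 hz
  have h2 : |z j| ≤ ‖z‖ := by
    have := PiLp.norm_apply_le (p := 2) z j
    rwa [Real.norm_eq_abs] at this
  have hs : 0 < ‖z‖ ^ 2 + ε ^ 2 := by positivity
  rw [regNewtonGrad_apply, abs_mul, abs_mul, abs_of_pos (by positivity : (0 : ℝ) < (4 * π)⁻¹),
    abs_of_pos (Real.rpow_pos_of_pos hs _), mul_assoc]
  refine mul_le_mul_of_nonneg_left ?_ (by positivity)
  have hz2 : 0 < ‖z‖ ^ 2 := by positivity
  calc |z j| * (‖z‖ ^ 2 + ε ^ 2) ^ (-(3 / 2 : ℝ)) ≤ ‖z‖ * (‖z‖ ^ 2) ^ (-(3 / 2 : ℝ)) :=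
        mul_le_mul h2 (Real.rpow_le_rpow_of_nonpos hz2 (by nlinarith [sq_nonneg ε]) (by norm_num))
          (Real.rpow_nonneg hs.le _) (norm_nonneg _)
    _ = ‖z‖ ^ (-2 : ℝ) := by
        rw [show (‖z‖ ^ 2 : ℝ) = ‖z‖ ^ (2 : ℝ) by norm_cast, ← Real.rpow_mul hz'.le,
          show (2 * -(3 / 2 : ℝ)) = -3 by norm_num]
        conv_lhs => rw [show (‖z‖ : ℝ) = ‖z‖ ^ (1 : ℝ) by rw [Real.rpow_one]]
        rw [← Real.rpow_mul hz'.le, one_mul, ← Real.rpow_add hz']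
        norm_num

/-- **The regularised kernels are singular kernels of degree `-2` with constants independent of
`ε`**: `A = (4π)⁻¹`, `B = 8/π` (size bound `abs_regNewtonGrad_le`; regularity by the mean value
inequality on the segment from `x − y` to `z − y`, all of whose points have norm `≥ |x − y|/2`,
with `‖D regNewtonGrad ε j (w)‖ ≤ π⁻¹|w|⁻³`) — the same constants as `isSingularKernel_newtonKernelGrad`.
[folklore] -/
theorem isSingularKernel_regNewtonGrad (hε : ε ≠ 0) (j : Fin 3) :
    IsSingularKernel (regNewtonGrad ε j) 2 (4 * π)⁻¹ (8 / π) where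
  measurable := measurable_regNewtonGrad hε j
  abs_le z := abs_regNewtonGrad_le ε j z
  abs_sub_le x z y hxz hy := by
    have hd : 0 < ‖x - z‖ := norm_pos_iff.2 (sub_ne_zero.2 hxz)
    have hxy : 0 < ‖x - y‖ := by linarith
    set C : ℝ := 8 / (π * ‖x - y‖ ^ 3) with hC
    have hseg : ∀ w ∈ segment ℝ (x - y) (z - y), ‖x - y‖ / 2 ≤ ‖w‖ := fun w hw =>
      half_norm_le_of_mem_segment hy hw
    have hne : ∀ w ∈ segment ℝ (x - y) (z - y), w ≠ 0 := fun w hw => by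
      have := hseg w hw
      rw [← norm_pos_iff]; linarith
    have hdiff : ∀ w ∈ segment ℝ (x - y) (z - y), DifferentiableAt ℝ (regNewtonGrad ε j) w :=
      fun w _ => differentiable_regNewtonGrad hε j w
    have hbound : ∀ w ∈ segment ℝ (x - y) (z - y), ‖fderiv ℝ (regNewtonGrad ε j) w‖ ≤ C := by
      intro w hw
      have hw0 := hne w hw
      have hw1 : 0 < ‖w‖ := norm_pos_iff.2 hw0
      have h2 := hseg w hw
      refine (norm_fderiv_regNewtonGrad_le_norm hε j hw0).trans ?_
      rw [hC, ← div_eq_mul_inv, div_le_div_iff₀ (by positivity) (by positivity),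
        inv_mul_cancel_left₀ Real.pi_pos.ne']
      have h4 : 0 < ‖x - y‖ / 2 := by linarith
      have h5 : (‖x - y‖ / 2) ^ 3 ≤ ‖w‖ ^ 3 := pow_le_pow_left₀ h4.le h2 3
      nlinarith [h5]
    have hmv := (convex_segment (x - y) (z - y)).norm_image_sub_le_of_norm_fderiv_le hdiff hbound
      (right_mem_segment ℝ (x - y) (z - y)) (left_mem_segment ℝ (x - y) (z - y))
    rw [show x - y - (z - y) = x - z by abel] at hmv
    rw [← Real.norm_eq_abs]
    refine hmv.trans (le_of_eq ?_)
    rw [hC, show (-(2 + 1) : ℝ) = -3 by norm_num, Real.rpow_neg (norm_nonneg _),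
      show (3 : ℝ) = ((3 : ℕ) : ℝ) by norm_num, Real.rpow_natCast]
    field_simp

/-! ### The approximate identity `regDelta` -/

/-- `regDelta ε z > 0` for `ε ≠ 0`. [folklore] -/
theorem regDelta_pos (hε : ε ≠ 0) (z : EuclideanSpace ℝ (Fin 3)) : 0 < regDelta ε z := by
  rw [regDelta_apply]
  have hs : 0 < ‖z‖ ^ 2 + ε ^ 2 := normSq_add_sq_pos hε z
  have : 0 < ε ^ 2 := by positivity
  have := Real.rpow_pos_of_pos hs (-(5 / 2 : ℝ))
  positivity

/-- `regDelta ε z ≥ 0`. [folklore] -/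
theorem regDelta_nonneg (ε : ℝ) (z : EuclideanSpace ℝ (Fin 3)) : 0 ≤ regDelta ε z := by
  rw [regDelta_apply]
  have : 0 ≤ (‖z‖ ^ 2 + ε ^ 2) ^ (-(5 / 2 : ℝ)) := Real.rpow_nonneg (by positivity) _
  positivity

/-- `regDelta ε` is continuous for `ε ≠ 0`. [folklore] -/
theorem continuous_regDelta (hε : ε ≠ 0) : Continuous (regDelta ε) := by
  unfold regDelta
  refine continuous_const.mul (Continuous.rpow_const (by fun_prop) fun z => Or.inl ?_)
  exact (normSq_add_sq_pos hε z).ne'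

/-- **Scaling**: `regDelta ε z = |ε|⁻³ regDelta 1 (ε⁻¹ z)` for `ε ≠ 0`. [folklore] -/
theorem regDelta_eq_scaled (hε : ε ≠ 0) (z : EuclideanSpace ℝ (Fin 3)) :
    regDelta ε z = (|ε| ^ 3)⁻¹ * regDelta 1 (ε⁻¹ • z) := by
  rw [regDelta_apply, regDelta_apply, norm_smul, norm_inv, Real.norm_eq_abs, one_pow, mul_one]
  have ha : 0 < |ε| := abs_pos.2 hε
  have hs1 : 0 < (|ε|⁻¹ * ‖z‖) ^ 2 + 1 := by positivity
  have hs : 0 < ‖z‖ ^ 2 + ε ^ 2 := normSq_add_sq_pos hε z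
  -- `(|ε|⁻¹|z|)² + 1 = |ε|⁻² (|z|² + ε²)`
  have e1 : (|ε|⁻¹ * ‖z‖) ^ 2 + 1 = (ε ^ 2)⁻¹ * (‖z‖ ^ 2 + ε ^ 2) := by
    have : ε ^ 2 = |ε| ^ 2 := (sq_abs ε).symm
    rw [this]
    field_simp
  rw [e1, Real.mul_rpow (by positivity) hs.le]
  have e2 : ((ε ^ 2)⁻¹ : ℝ) ^ (-(5 / 2 : ℝ)) = |ε| ^ 5 := by
    rw [Real.inv_rpow (by positivity), Real.rpow_neg (by positivity), inv_inv,
      show (ε ^ 2 : ℝ) = |ε| ^ (2 : ℝ) by rw [← sq_abs]; norm_cast, ← Real.rpow_mul ha.le,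
      show (2 * (5 / 2 : ℝ)) = 5 by norm_num, show (5 : ℝ) = ((5 : ℕ) : ℝ) by norm_num,
      Real.rpow_natCast]
  rw [e2]
  have e3 : ε ^ 2 = |ε| ^ 2 := (sq_abs ε).symm
  rw [e3]
  field_simp

/-- `regDelta 1 z ≤ (3/(4π)) (1 + |z|²)^{-5/2}` (in fact equality), the Japanese-bracket majorant.
[folklore] -/
theorem regDelta_one_eq (z : EuclideanSpace ℝ (Fin 3)) :
    regDelta 1 z = (4 * π)⁻¹ * 3 * ((1 : ℝ) + ‖z‖ ^ 2) ^ (-(5 : ℝ) / 2) := by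
  rw [regDelta_apply, one_pow, mul_one, add_comm (‖z‖ ^ 2) 1]
  norm_num

/-- `regDelta 1` is integrable on `ℝ³` (`(1 + |z|²)^{-5/2}` with `5 > 3`). [folklore] -/
theorem integrable_regDelta_one : Integrable (regDelta (1 : ℝ)) volume := by
  have h := (integrable_rpow_neg_one_add_norm_sq (E := EuclideanSpace ℝ (Fin 3))
    (μ := volume) (r := 5) (by rw [finrank_euclideanSpace_fin]; norm_num)).const_mul
    ((4 * π)⁻¹ * 3)
  refine h.congr (Eventually.of_forall fun z => ?_)
  simp only [regDelta_one_eq]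

/-- `z ↦ |z| regDelta 1 z` is integrable on `ℝ³` (`|z| (1 + |z|²)^{-5/2} ≤ (1 + |z|²)^{-2}` with
`4 > 3`). [folklore] -/
theorem integrable_norm_mul_regDelta_one :
    Integrable (fun z : EuclideanSpace ℝ (Fin 3) => ‖z‖ * regDelta 1 z) volume := by
  have h := (integrable_rpow_neg_one_add_norm_sq (E := EuclideanSpace ℝ (Fin 3))
    (μ := volume) (r := 4) (by rw [finrank_euclideanSpace_fin]; norm_num)).const_mul
    ((4 * π)⁻¹ * 3)
  refine h.mono' ?_ (Eventually.of_forall fun z => ?_)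
  · exact (continuous_norm.mul (continuous_regDelta one_ne_zero)).aestronglyMeasurable
  rw [Real.norm_eq_abs, abs_of_nonneg (mul_nonneg (norm_nonneg _) (regDelta_nonneg 1 z)),
    regDelta_one_eq]
  have hb : 0 < (1 : ℝ) + ‖z‖ ^ 2 := by positivity
  have hpi : 0 < (4 * π)⁻¹ * 3 := by positivity
  -- `|z| (1+|z|²)^{-5/2} ≤ (1+|z|²)^{1/2} (1+|z|²)^{-5/2} = (1+|z|²)^{-2}`
  have h1 : ‖z‖ ≤ ((1 : ℝ) + ‖z‖ ^ 2) ^ ((1 : ℝ) / 2) := by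
    rw [← Real.sqrt_eq_rpow]
    refine Real.le_sqrt_of_sq_le ?_
    linarith
  calc ‖z‖ * ((4 * π)⁻¹ * 3 * ((1 : ℝ) + ‖z‖ ^ 2) ^ (-(5 : ℝ) / 2))
      = (4 * π)⁻¹ * 3 * (‖z‖ * ((1 : ℝ) + ‖z‖ ^ 2) ^ (-(5 : ℝ) / 2)) := by ring
    _ ≤ (4 * π)⁻¹ * 3 * (((1 : ℝ) + ‖z‖ ^ 2) ^ ((1 : ℝ) / 2) *
          ((1 : ℝ) + ‖z‖ ^ 2) ^ (-(5 : ℝ) / 2)) := by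
        gcongr
    _ = (4 * π)⁻¹ * 3 * ((1 : ℝ) + ‖z‖ ^ 2) ^ (-(4 : ℝ) / 2) := by
        rw [← Real.rpow_add hb]
        norm_num

/-- The **total mass** `m₀ = ∫ regDelta 1` is positive. [folklore] -/
theorem integral_regDelta_one_pos : 0 < ∫ z, regDelta (1 : ℝ) z := by
  rw [integral_pos_iff_support_of_nonneg (fun z => regDelta_nonneg 1 z) integrable_regDelta_one]
  have hsupp : support (regDelta (1 : ℝ)) = univ := by
    ext z
    simp only [mem_support, mem_univ, iff_true]
    exact (regDelta_pos one_ne_zero z).ne'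
  rw [hsupp]
  simp

/-- **Change of variables for the approximate identity**: for `ε ≠ 0` and any `g`,
`∫ regDelta ε (x − y) g(y) dy = ∫ regDelta 1 (u) g(x − ε u) du`. [folklore] -/
theorem integral_regDelta_mul_eq (hε : ε ≠ 0) (g : EuclideanSpace ℝ (Fin 3) → ℝ)
    (x : EuclideanSpace ℝ (Fin 3)) :
    ∫ y, regDelta ε (x - y) * g y = ∫ u, regDelta 1 u * g (x - ε • u) := by
  -- `y ↦ x - y`
  have h1 : ∫ y, regDelta ε (x - y) * g y = ∫ y, regDelta ε y * g (x - y) := by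
    have h := integral_sub_left_eq_self (fun y => regDelta ε y * g (x - y)) volume x
    simp only [sub_sub_cancel] at h
    exact h
  rw [h1]
  -- `y = ε • u`, i.e. `u = ε⁻¹ • y`
  have h2 : ∫ y, regDelta ε y * g (x - y) =
      ∫ y, (|ε| ^ 3)⁻¹ * (regDelta 1 (ε⁻¹ • y) * g (x - ε • (ε⁻¹ • y))) := by
    refine integral_congr_ae (Eventually.of_forall fun y => ?_)
    simp only
    rw [regDelta_eq_scaled hε, smul_smul, mul_inv_cancel₀ hε, one_smul]
    ring
  rw [h2, integral_const_mul]
  have h3 := Measure.integral_comp_inv_smul (volume : Measure (EuclideanSpace ℝ (Fin 3)))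
    (fun u => regDelta 1 u * g (x - ε • u)) ε
  rw [finrank_euclideanSpace_fin] at h3
  rw [h3, smul_eq_mul, ← mul_assoc, abs_pow,
    inv_mul_cancel₀ (by positivity : (|ε| ^ 3 : ℝ) ≠ 0), one_mul]

/-- **Approximate identity estimate**: for an `L`-Lipschitz `g` and `ε ≠ 0`,
`|∫ regDelta ε (x − y) g(y) dy − m₀ g(x)| ≤ L |ε| m₁`, with the mass `m₀ = ∫ regDelta 1` and the
first moment `m₁ = ∫ |u| regDelta 1 u du`. [folklore] -/
theorem abs_integral_regDelta_mul_sub_le (hε : ε ≠ 0) {g : EuclideanSpace ℝ (Fin 3) → ℝ}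
    {L : ℝ≥0} (hg : LipschitzWith L g) (x : EuclideanSpace ℝ (Fin 3)) :
    |(∫ y, regDelta ε (x - y) * g y) - (∫ z, regDelta (1 : ℝ) z) * g x| ≤
      L * |ε| * ∫ z, ‖z‖ * regDelta 1 z := by
  rw [integral_regDelta_mul_eq hε g x]
  have hgc : Continuous g := hg.continuous
  -- the pointwise Lipschitz bound
  have hbound : ∀ u, |regDelta 1 u * g (x - ε • u) - regDelta 1 u * g x| ≤
      L * |ε| * (‖u‖ * regDelta 1 u) := by
    intro u
    rw [← mul_sub, abs_mul, abs_of_nonneg (regDelta_nonneg 1 u)]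
    have h := hg.norm_sub_le (x - ε • u) x
    have e : x - ε • u - x = -(ε • u) := by abel
    rw [e, norm_neg, norm_smul, Real.norm_eq_abs, Real.norm_eq_abs] at h
    calc regDelta 1 u * |g (x - ε • u) - g x| ≤ regDelta 1 u * (L * (|ε| * ‖u‖)) :=
          mul_le_mul_of_nonneg_left h (regDelta_nonneg 1 u)
      _ = L * |ε| * (‖u‖ * regDelta 1 u) := by ring
  have hint1 : Integrable (fun u => regDelta 1 u * g x) volume :=
    integrable_regDelta_one.mul_const _
  -- integrability of `u ↦ regDelta 1 u * g (x - ε u)`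
  have hint2 : Integrable (fun u => regDelta 1 u * g (x - ε • u)) volume := by
    have hc1 : Continuous (regDelta (1 : ℝ)) := continuous_regDelta one_ne_zero
    have hc2 : Continuous fun u : EuclideanSpace ℝ (Fin 3) => x - ε • u := by fun_prop
    have hmeas : AEStronglyMeasurable (fun u => regDelta 1 u * g (x - ε • u)) volume :=
      (hc1.mul (hgc.comp hc2)).aestronglyMeasurable
    refine Integrable.mono'
      (g := fun u => regDelta 1 u * |g x| + (L : ℝ) * |ε| * (‖u‖ * regDelta 1 u)) ?_ hmeas
      (Eventually.of_forall fun u => ?_)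
    · exact (integrable_regDelta_one.mul_const |g x|).add
        (integrable_norm_mul_regDelta_one.const_mul ((L : ℝ) * |ε|))
    · rw [Real.norm_eq_abs, abs_mul, abs_of_nonneg (regDelta_nonneg 1 u)]
      have hsub : |g (x - ε • u)| ≤ |g x| + |g (x - ε • u) - g x| := by
        have := abs_add_le (g x) (g (x - ε • u) - g x)
        rwa [add_sub_cancel] at this
      have hb := hbound u
      rw [← mul_sub, abs_mul, abs_of_nonneg (regDelta_nonneg 1 u)] at hb
      calc regDelta 1 u * |g (x - ε • u)| ≤ regDelta 1 u * (|g x| + |g (x - ε • u) - g x|) :=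
            mul_le_mul_of_nonneg_left hsub (regDelta_nonneg 1 u)
        _ = regDelta 1 u * |g x| + regDelta 1 u * |g (x - ε • u) - g x| := mul_add _ _ _
        _ ≤ regDelta 1 u * |g x| + L * |ε| * (‖u‖ * regDelta 1 u) := by linarith
  rw [← integral_mul_const, ← integral_sub hint2 hint1]
  calc |∫ u, regDelta 1 u * g (x - ε • u) - regDelta 1 u * g x|
      ≤ ∫ u, |regDelta 1 u * g (x - ε • u) - regDelta 1 u * g x| := by
        have := norm_integral_le_integral_norm (μ := (volume : Measure (EuclideanSpace ℝ (Fin 3))))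
          (fun u => regDelta 1 u * g (x - ε • u) - regDelta 1 u * g x)
        simpa only [Real.norm_eq_abs] using this
    _ ≤ ∫ u, L * |ε| * (‖u‖ * regDelta 1 u) := by
        refine integral_mono_of_nonneg (Eventually.of_forall fun u => abs_nonneg _)
          (integrable_norm_mul_regDelta_one.const_mul _) (Eventually.of_forall hbound)
    _ = L * |ε| * ∫ z, ‖z‖ * regDelta 1 z := integral_const_mul _ _

end NewtonPotentialHolder

end Literature.Analysis.FluidPDE
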